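import Summits.AnomalousDissipation.AnomalousDissipation.Theorems.SawtoothPulseCascadeK1LocalisedCascadeLedgerCutoffSchedule

/-!
# K1loc, line `Spectral` / SeqCone — helper: GEOMETRIC MAJORANTS OF THE CONCRETE HALF-SLOT ERRORS, I (term lemmas)

Helper file of the prover lane on the crux `K1LocalisedCascade` (stmt-AnomalousDissipation-19491), route
`SawtoothPulseCascade` (S-B/S-C assembly seat).  The concrete half-slot steps
`…K1Ledger.cascade_ledger_step_H_concrete` / `…cascade_ledger_step_V_concrete` bound the per-slot amplitude error by
`X_j·‖θ₀‖` with `X_j` an explicit sum of eight terms in the phase data.  Along the schedule of `…LedgerSchedule` /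
`…LedgerCutoffSchedule` (`b_j = L₀ρ^j/(20γ_b(1+1/250))`, `Λ_j = (2π/δ₀)4^j`, `ε_j = 1/(1000Γ^j)`, `M_j ≤ M̄(j+1)`,
envelope `≤ c_R L₀Γ^j`, `κ·r^{2j} ≤ 1` on the ledger's phases) this file proves, TERM BY TERM and purely in real variables,
bounds of the form `term ≤ A_t·(j+1)²Θ₀^j` with `A_t` independent of `j, κ, M_j` whenever `16/ρ ≤ Θ₀²`, `1/2 ≤ Θ₀²`,
`Θ₀ ≤ 1`, `ρ ≤ r²` (§1 rates; §2 the cut-off constants `c₁ ≤ c̄₁(j+1)4^j`, `c₂ ≤ c̄₂(j+1)²16^j`; §3 the eight terms).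
The sum is assembled in the companion file `…LedgerMajorantsSum`.  No definitions; no statement about the stub.
[cite: ElgindiLissMattingly2025, §1.2.1 (|log ν| pulse count) and §3.1] [problem: turb]
-/

-- `Summit.<Summit>.<Problem>`: single-conjunct summit, the duplicate namespace segment is deliberate.
set_option linter.dupNamespace false

noncomputable section

namespace Summit.AnomalousDissipation.AnomalousDissipation.Theorems.SawtoothPulseCascade.K1Ledger

open Real

/-! ## §1 Rates against `Θ₀` -/

/-- `(x/ρ)^j ≤ (Θ₀^j)²` for `0 ≤ x ≤ 16`, `16/ρ ≤ Θ₀²`, `ρ > 0`. [folklore] -/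
theorem div_pow_le_sq {x ρ Θ₀ : ℝ} (hρ : 0 < ρ) (hx : 0 ≤ x) (hx16 : x ≤ 16) (h16 : 16 / ρ ≤ Θ₀ ^ 2) (j : ℕ) :
    (x / ρ) ^ j ≤ (Θ₀ ^ j) ^ 2 := by
  rw [← pow_mul, mul_comm, pow_mul]
  exact pow_le_pow_left₀ (by positivity) ((div_le_div_of_nonneg_right hx16 hρ.le).trans h16) j

/-- `(Θ₀^j)² ≤ Θ₀^j` for `0 ≤ Θ₀ ≤ 1`. [folklore] -/
theorem pow_sq_le_pow {Θ₀ : ℝ} (h0 : 0 ≤ Θ₀) (h1 : Θ₀ ≤ 1) (j : ℕ) : (Θ₀ ^ j) ^ 2 ≤ Θ₀ ^ j :=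
  pow_le_of_le_one (pow_nonneg h0 j) (pow_le_one₀ h0 h1) (by norm_num)

/-- `κ·16^j ≤ (Θ₀^j)²` when `κ r^{2j} ≤ 1`, `ρ ≤ r²`, `16/ρ ≤ Θ₀²`. [cite: ElgindiLissMattingly2025, §1.2.1] -/
theorem kappa_mul_pow_le {κ r ρ Θ₀ : ℝ} (hr : 1 ≤ r) (hρ : 0 < ρ) (hρr : ρ ≤ r ^ 2) (h16 : 16 / ρ ≤ Θ₀ ^ 2) (j : ℕ)
    (hκr : κ * r ^ (2 * j) ≤ 1) : κ * 16 ^ j ≤ (Θ₀ ^ j) ^ 2 := by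
  have hr0 : 0 < r := by linarith
  have e : κ * 16 ^ j = (κ * r ^ (2 * j)) * (16 / r ^ 2) ^ j := by
    rw [div_pow, ← pow_mul]; field_simp
  rw [e]
  have h2 : (16 / r ^ 2) ^ j ≤ (16 / ρ) ^ j :=
    pow_le_pow_left₀ (by positivity) (div_le_div_of_nonneg_left (by norm_num) hρ hρr) j
  calc κ * r ^ (2 * j) * (16 / r ^ 2) ^ j ≤ 1 * (16 / r ^ 2) ^ j :=
        mul_le_mul_of_nonneg_right hκr (by positivity)
    _ ≤ (Θ₀ ^ j) ^ 2 := by rw [one_mul]; exact h2.trans (div_pow_le_sq hρ (by norm_num) le_rfl h16 j)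

/-- `√κ·4^j ≤ Θ₀^j` under the same hypotheses (`κ ≥ 0`, `Θ₀ ≥ 0`). [cite: ElgindiLissMattingly2025, §1.2.1] -/
theorem sqrt_kappa_mul_pow_le {κ r ρ Θ₀ : ℝ} (hκ : 0 ≤ κ) (hΘ : 0 ≤ Θ₀) (hr : 1 ≤ r) (hρ : 0 < ρ) (hρr : ρ ≤ r ^ 2)
    (h16 : 16 / ρ ≤ Θ₀ ^ 2) (j : ℕ) (hκr : κ * r ^ (2 * j) ≤ 1) : Real.sqrt κ * 4 ^ j ≤ Θ₀ ^ j := by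
  have h16j : ((4 : ℝ) ^ j) ^ 2 = 16 ^ j := by rw [← pow_mul, mul_comm, pow_mul]; norm_num
  have h : (Real.sqrt κ * 4 ^ j) ^ 2 ≤ (Θ₀ ^ j) ^ 2 := by
    rw [mul_pow, Real.sq_sqrt hκ, h16j]; exact kappa_mul_pow_le hr hρ hρr h16 j hκr
  exact (pow_le_pow_iff_left₀ (by positivity) (pow_nonneg hΘ j) (by norm_num : (2 : ℕ) ≠ 0)).1 h

/-- `Γ^{-j} ≤ (Θ₀^j)²` for `Γ ≥ 2`, `1/2 ≤ Θ₀²`. [folklore] -/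
theorem inv_pow_le_sq {G Θ₀ : ℝ} (hG : 2 ≤ G) (hhalf : 1 / 2 ≤ Θ₀ ^ 2) (j : ℕ) : (G ^ j)⁻¹ ≤ (Θ₀ ^ j) ^ 2 := by
  have h1 : (G ^ j)⁻¹ = (1 / G) ^ j := by rw [one_div, inv_pow]
  rw [h1, ← pow_mul, mul_comm, pow_mul]
  have hG0 : 0 < G := by linarith
  exact pow_le_pow_left₀ (by positivity) ((div_le_div_of_nonneg_left zero_le_one (by norm_num) hG).trans hhalf) j

/-! ## §2 The cut-off constants along the flat-layer schedule -/

/-- `c₁ = 2C₁(M+4)Λ_j ≤ c̄₁·(j+1)4^j` with `c̄₁ = 2C₁(M̄+4)(2π/δ₀)`, for `M ≤ M̄(j+1)`. [folklore] -/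
theorem c_one_le {C₁ δ₀ M Mb : ℝ} (hC₁ : 0 ≤ C₁) (hδ₀ : 0 < δ₀) (j : ℕ) (hMle : M ≤ Mb * ((j : ℝ) + 1)) :
    2 * C₁ * (M + 4) * (2 * Real.pi / δ₀ * 4 ^ j) ≤ 2 * C₁ * (Mb + 4) * (2 * Real.pi / δ₀) * (((j : ℝ) + 1) * 4 ^ j) := by
  have hj1 : (1 : ℝ) ≤ (j : ℝ) + 1 := by have : (0 : ℝ) ≤ j := Nat.cast_nonneg j; linarith
  have hM4 : M + 4 ≤ (Mb + 4) * ((j : ℝ) + 1) := by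
    have h4 : (4 : ℝ) ≤ 4 * ((j : ℝ) + 1) := by linarith only [hj1]
    linarith only [hMle, h4]
  calc 2 * C₁ * (M + 4) * (2 * Real.pi / δ₀ * 4 ^ j) = 2 * C₁ * (2 * Real.pi / δ₀) * 4 ^ j * (M + 4) := by ring
    _ ≤ 2 * C₁ * (2 * Real.pi / δ₀) * 4 ^ j * ((Mb + 4) * ((j : ℝ) + 1)) :=
        mul_le_mul_of_nonneg_left hM4 (by positivity)
    _ = 2 * C₁ * (Mb + 4) * (2 * Real.pi / δ₀) * (((j : ℝ) + 1) * 4 ^ j) := by ring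

/-- `c₂ = (4C₂(M+4)² + 2C₁(2M²+33))Λ_j² ≤ c̄₂·(j+1)²16^j` with `c̄₂ = (4C₂(M̄+4)² + 2C₁(2M̄²+33))(2π/δ₀)²`, for `0 ≤ M`,
`M ≤ M̄(j+1)`, `M² ≤ M̄²(j+1)`. [folklore] -/
theorem c_two_le {C₁ C₂ δ₀ M Mb : ℝ} (hC₁ : 0 ≤ C₁) (hC₂ : 0 ≤ C₂) (hδ₀ : 0 < δ₀) (j : ℕ) (hM : 0 ≤ M)
    (hMle : M ≤ Mb * ((j : ℝ) + 1)) (hM2le : M ^ 2 ≤ Mb ^ 2 * ((j : ℝ) + 1)) :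
    (4 * C₂ * (M + 4) ^ 2 + 2 * C₁ * (2 * M ^ 2 + 33)) * (2 * Real.pi / δ₀ * 4 ^ j) ^ 2 ≤
      (4 * C₂ * (Mb + 4) ^ 2 + 2 * C₁ * (2 * Mb ^ 2 + 33)) * (2 * Real.pi / δ₀) ^ 2 *
        (((j : ℝ) + 1) ^ 2 * 16 ^ j) := by
  have hj1 : (1 : ℝ) ≤ (j : ℝ) + 1 := by have : (0 : ℝ) ≤ j := Nat.cast_nonneg j; linarith
  have hj2 : (j : ℝ) + 1 ≤ ((j : ℝ) + 1) ^ 2 := le_self_pow₀ hj1 (by norm_num)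
  have hM4 : M + 4 ≤ (Mb + 4) * ((j : ℝ) + 1) := by
    have h4 : (4 : ℝ) ≤ 4 * ((j : ℝ) + 1) := by linarith only [hj1]
    linarith only [hMle, h4]
  have hM40 : 0 ≤ M + 4 := by linarith only [hM]
  have h2M : 2 * M ^ 2 + 33 ≤ (2 * Mb ^ 2 + 33) * ((j : ℝ) + 1) := by
    have h33 : (33 : ℝ) ≤ 33 * ((j : ℝ) + 1) := by linarith only [hj1]
    linarith only [hM2le, h33]
  have h16 : (2 * Real.pi / δ₀ * 4 ^ j) ^ 2 = (2 * Real.pi / δ₀) ^ 2 * 16 ^ j := by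
    rw [mul_pow, ← pow_mul, show (4 : ℝ) ^ (j * 2) = 16 ^ j by rw [mul_comm, pow_mul]; norm_num]
  rw [h16]
  have hA : 4 * C₂ * (M + 4) ^ 2 ≤ 4 * C₂ * (Mb + 4) ^ 2 * ((j : ℝ) + 1) ^ 2 := by
    have : (M + 4) ^ 2 ≤ ((Mb + 4) * ((j : ℝ) + 1)) ^ 2 := pow_le_pow_left₀ hM40 hM4 2
    calc 4 * C₂ * (M + 4) ^ 2 ≤ 4 * C₂ * ((Mb + 4) * ((j : ℝ) + 1)) ^ 2 := mul_le_mul_of_nonneg_left this (by positivity)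
      _ = 4 * C₂ * (Mb + 4) ^ 2 * ((j : ℝ) + 1) ^ 2 := by ring
  have hB : 2 * C₁ * (2 * M ^ 2 + 33) ≤ 2 * C₁ * (2 * Mb ^ 2 + 33) * ((j : ℝ) + 1) ^ 2 := by
    have h' : (2 * Mb ^ 2 + 33) * ((j : ℝ) + 1) ≤ (2 * Mb ^ 2 + 33) * ((j : ℝ) + 1) ^ 2 :=
      mul_le_mul_of_nonneg_left hj2 (by positivity)
    calc 2 * C₁ * (2 * M ^ 2 + 33) ≤ 2 * C₁ * ((2 * Mb ^ 2 + 33) * ((j : ℝ) + 1) ^ 2) :=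
          mul_le_mul_of_nonneg_left (h2M.trans h') (by positivity)
      _ = 2 * C₁ * (2 * Mb ^ 2 + 33) * ((j : ℝ) + 1) ^ 2 := by ring
  calc (4 * C₂ * (M + 4) ^ 2 + 2 * C₁ * (2 * M ^ 2 + 33)) * ((2 * Real.pi / δ₀) ^ 2 * 16 ^ j)
      ≤ (4 * C₂ * (Mb + 4) ^ 2 * ((j : ℝ) + 1) ^ 2 + 2 * C₁ * (2 * Mb ^ 2 + 33) * ((j : ℝ) + 1) ^ 2) *
          ((2 * Real.pi / δ₀) ^ 2 * 16 ^ j) := mul_le_mul_of_nonneg_right (add_le_add hA hB) (by positivity)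
    _ = (4 * C₂ * (Mb + 4) ^ 2 + 2 * C₁ * (2 * Mb ^ 2 + 33)) * (2 * Real.pi / δ₀) ^ 2 *
        (((j : ℝ) + 1) ^ 2 * 16 ^ j) := by ring

/-! ## §3 The eight terms

Throughout: `Φ_j = (j+1)²Θ₀^j`, fibre scale `b_j = L₀ρ^j/(20γ_b(1+1/250))` so that `C/b_j = C·c_b·(ρ^j)⁻¹` with
`c_b = 20γ_b(1+1/250)/L₀`; the cut-off constants enter only through `0 ≤ c₁ ≤ c̄₁(j+1)4^j`, `0 ≤ c₂ ≤ c̄₂(j+1)²16^j`. -/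

/-- The fibre scale inverted: `C/b_j = C·(20γ_b(1+1/250)/L₀)·(ρ^j)⁻¹`. [folklore] -/
theorem div_fibreScale_eq {L₀ ρ γb : ℝ} (hL₀ : 0 < L₀) (hρ : 0 < ρ) (hγb : 0 < γb) (j : ℕ) (C : ℝ) :
    C / (L₀ * ρ ^ j / (20 * γb * (1 + 1 / 250))) = C * (20 * γb * (1 + 1 / 250) / L₀) * (ρ ^ j)⁻¹ := by
  have hρj : 0 < ρ ^ j := pow_pos hρ j
  field_simp

/-- **`c₂/ρ^j ≤ c̄₂·Φ_j`.** [folklore] -/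
theorem c_two_div_le {c₂ cc₂ ρ Θ₀ : ℝ} (hρ : 0 < ρ) (hΘ0 : 0 ≤ Θ₀) (hΘ1 : Θ₀ ≤ 1) (h16 : 16 / ρ ≤ Θ₀ ^ 2) (hcc₂ : 0 ≤ cc₂)
    (j : ℕ) (hc₂le : c₂ ≤ cc₂ * (((j : ℝ) + 1) ^ 2 * 16 ^ j)) :
    c₂ * (ρ ^ j)⁻¹ ≤ cc₂ * (((j : ℝ) + 1) ^ 2 * Θ₀ ^ j) := by
  have hρj : 0 < ρ ^ j := pow_pos hρ j
  have hrate : (16 / ρ) ^ j ≤ Θ₀ ^ j := (div_pow_le_sq hρ (by norm_num) le_rfl h16 j).trans (pow_sq_le_pow hΘ0 hΘ1 j)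
  calc c₂ * (ρ ^ j)⁻¹ ≤ cc₂ * (((j : ℝ) + 1) ^ 2 * 16 ^ j) * (ρ ^ j)⁻¹ :=
        mul_le_mul_of_nonneg_right hc₂le (by positivity)
    _ = cc₂ * (((j : ℝ) + 1) ^ 2 * (16 / ρ) ^ j) := by rw [div_pow]; field_simp
    _ ≤ cc₂ * (((j : ℝ) + 1) ^ 2 * Θ₀ ^ j) := mul_le_mul_of_nonneg_left (mul_le_mul_of_nonneg_left hrate (by positivity)) hcc₂

/-- **`c₁/ρ^j ≤ c̄₁·((j+1)Θ₀^j)²·`… precisely `c₁/ρ^j ≤ c̄₁·(j+1)²(Θ₀^j)²`** (one power of `Θ₀^j` to spare). [folklore] -/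
theorem c_one_div_le {c₁ cc₁ ρ Θ₀ : ℝ} (hρ : 0 < ρ) (h16 : 16 / ρ ≤ Θ₀ ^ 2) (hcc₁ : 0 ≤ cc₁) (j : ℕ)
    (hc₁le : c₁ ≤ cc₁ * (((j : ℝ) + 1) * 4 ^ j)) :
    c₁ * (ρ ^ j)⁻¹ ≤ cc₁ * (((j : ℝ) + 1) ^ 2 * (Θ₀ ^ j) ^ 2) := by
  have hρj : 0 < ρ ^ j := pow_pos hρ j
  have hj1 : (1 : ℝ) ≤ (j : ℝ) + 1 := by have : (0 : ℝ) ≤ j := Nat.cast_nonneg j; linarith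
  have hj2 : (j : ℝ) + 1 ≤ ((j : ℝ) + 1) ^ 2 := le_self_pow₀ hj1 (by norm_num)
  have h4 : (4 / ρ) ^ j ≤ (Θ₀ ^ j) ^ 2 := div_pow_le_sq hρ (by norm_num) (by norm_num) h16 j
  calc c₁ * (ρ ^ j)⁻¹ ≤ cc₁ * (((j : ℝ) + 1) * 4 ^ j) * (ρ ^ j)⁻¹ := mul_le_mul_of_nonneg_right hc₁le (by positivity)
    _ = cc₁ * (((j : ℝ) + 1) * (4 / ρ) ^ j) := by rw [div_pow]; field_simp
    _ ≤ cc₁ * (((j : ℝ) + 1) ^ 2 * (Θ₀ ^ j) ^ 2) :=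
        mul_le_mul_of_nonneg_left (mul_le_mul hj2 h4 (by positivity) (by positivity)) hcc₁

/-- **`(c₂ + 2πc₁ + π²)/ρ^j ≤ (c̄₂ + 2πc̄₁ + π²)·(j+1)²(Θ₀^j)²`.** [folklore] -/
theorem c_sum_div_le {c₁ c₂ cc₁ cc₂ ρ Θ₀ : ℝ} (hρ : 0 < ρ) (h16 : 16 / ρ ≤ Θ₀ ^ 2)
    (hcc₁ : 0 ≤ cc₁) (hcc₂ : 0 ≤ cc₂) (j : ℕ) (hc₁le : c₁ ≤ cc₁ * (((j : ℝ) + 1) * 4 ^ j))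
    (hc₂le : c₂ ≤ cc₂ * (((j : ℝ) + 1) ^ 2 * 16 ^ j)) :
    (c₂ + 2 * Real.pi * c₁ + Real.pi ^ 2) * (ρ ^ j)⁻¹ ≤
      (cc₂ + 2 * Real.pi * cc₁ + Real.pi ^ 2) * (((j : ℝ) + 1) ^ 2 * (Θ₀ ^ j) ^ 2) := by
  have hρj : 0 < ρ ^ j := pow_pos hρ j
  have hπ := Real.pi_pos.le
  have hj1 : (1 : ℝ) ≤ (j : ℝ) + 1 := by have : (0 : ℝ) ≤ j := Nat.cast_nonneg j; linarith
  have hj3 : (1 : ℝ) ≤ ((j : ℝ) + 1) ^ 2 := one_le_pow₀ hj1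
  have e2 : c₂ * (ρ ^ j)⁻¹ ≤ cc₂ * (((j : ℝ) + 1) ^ 2 * (Θ₀ ^ j) ^ 2) := by
    calc c₂ * (ρ ^ j)⁻¹ ≤ cc₂ * (((j : ℝ) + 1) ^ 2 * 16 ^ j) * (ρ ^ j)⁻¹ :=
          mul_le_mul_of_nonneg_right hc₂le (by positivity)
      _ = cc₂ * (((j : ℝ) + 1) ^ 2 * (16 / ρ) ^ j) := by rw [div_pow]; field_simp
      _ ≤ cc₂ * (((j : ℝ) + 1) ^ 2 * (Θ₀ ^ j) ^ 2) := mul_le_mul_of_nonneg_left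
          (mul_le_mul_of_nonneg_left (div_pow_le_sq hρ (by norm_num) le_rfl h16 j) (by positivity)) hcc₂
  have e1 := c_one_div_le hρ h16 hcc₁ j hc₁le
  have e0 : (ρ ^ j)⁻¹ ≤ ((j : ℝ) + 1) ^ 2 * (Θ₀ ^ j) ^ 2 := by
    calc (ρ ^ j)⁻¹ = (1 / ρ) ^ j := by rw [one_div, inv_pow]
      _ ≤ (Θ₀ ^ j) ^ 2 := div_pow_le_sq hρ (by norm_num) (by norm_num) h16 j
      _ ≤ ((j : ℝ) + 1) ^ 2 * (Θ₀ ^ j) ^ 2 := le_mul_of_one_le_left (by positivity) hj3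
  calc (c₂ + 2 * Real.pi * c₁ + Real.pi ^ 2) * (ρ ^ j)⁻¹
      = c₂ * (ρ ^ j)⁻¹ + 2 * Real.pi * (c₁ * (ρ ^ j)⁻¹) + Real.pi ^ 2 * (ρ ^ j)⁻¹ := by ring
    _ ≤ cc₂ * (((j : ℝ) + 1) ^ 2 * (Θ₀ ^ j) ^ 2) + 2 * Real.pi * (cc₁ * (((j : ℝ) + 1) ^ 2 * (Θ₀ ^ j) ^ 2)) +
        Real.pi ^ 2 * (((j : ℝ) + 1) ^ 2 * (Θ₀ ^ j) ^ 2) := by gcongr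
    _ = (cc₂ + 2 * Real.pi * cc₁ + Real.pi ^ 2) * (((j : ℝ) + 1) ^ 2 * (Θ₀ ^ j) ^ 2) := by ring

/-- **Term 1/5 shape: `(C/b_j)·(S/D) ≤ C c_b (S̄/D)·Φ_j`** whenever `S/ρ^j ≤ S̄·Φ_j` (`D > 0`). [folklore] -/
theorem fibre_term_le {C L₀ ρ γb S Sb D Φ : ℝ} (hL₀ : 0 < L₀) (hρ : 0 < ρ) (hγb : 0 < γb) (hC : 0 ≤ C) (hD : 0 < D)
    (j : ℕ) (hS : S * (ρ ^ j)⁻¹ ≤ Sb * Φ) :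
    C / (L₀ * ρ ^ j / (20 * γb * (1 + 1 / 250))) * (S / D) ≤ C * (20 * γb * (1 + 1 / 250) / L₀) * (Sb / D) * Φ := by
  rw [div_fibreScale_eq hL₀ hρ hγb j C]
  have hcb : 0 ≤ C * (20 * γb * (1 + 1 / 250) / L₀) := by positivity
  calc C * (20 * γb * (1 + 1 / 250) / L₀) * (ρ ^ j)⁻¹ * (S / D)
      = C * (20 * γb * (1 + 1 / 250) / L₀) * ((S * (ρ ^ j)⁻¹) / D) := by ring
    _ ≤ C * (20 * γb * (1 + 1 / 250) / L₀) * ((Sb * Φ) / D) := by gcongr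
    _ = C * (20 * γb * (1 + 1 / 250) / L₀) * (Sb / D) * Φ := by ring

/-- **Term 2: `2κ·tH·c₂ ≤ 2c̄₂·Φ_j`** (`κ16^j ≤ (Θ₀^j)²`, `tH ≤ 1`). [cite: ElgindiLissMattingly2025, §1.2.1] -/
theorem term_two_le {κ tH c₂ cc₂ Θ₀ : ℝ} (hκ : 0 ≤ κ) (htH1 : tH ≤ 1) (hΘ0 : 0 ≤ Θ₀) (hΘ1 : Θ₀ ≤ 1)
    (hcc₂ : 0 ≤ cc₂) (j : ℕ) (hc₂0 : 0 ≤ c₂) (hc₂le : c₂ ≤ cc₂ * (((j : ℝ) + 1) ^ 2 * 16 ^ j))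
    (hκ16 : κ * 16 ^ j ≤ (Θ₀ ^ j) ^ 2) :
    2 * κ * tH * c₂ ≤ 2 * cc₂ * (((j : ℝ) + 1) ^ 2 * Θ₀ ^ j) := by
  have h1 : κ * c₂ ≤ cc₂ * (((j : ℝ) + 1) ^ 2 * Θ₀ ^ j) := by
    calc κ * c₂ ≤ κ * (cc₂ * (((j : ℝ) + 1) ^ 2 * 16 ^ j)) := mul_le_mul_of_nonneg_left hc₂le hκ
      _ = cc₂ * (((j : ℝ) + 1) ^ 2 * (κ * 16 ^ j)) := by ring
      _ ≤ cc₂ * (((j : ℝ) + 1) ^ 2 * Θ₀ ^ j) := mul_le_mul_of_nonneg_left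
          (mul_le_mul_of_nonneg_left (hκ16.trans (pow_sq_le_pow hΘ0 hΘ1 j)) (by positivity)) hcc₂
  have h0 : 0 ≤ cc₂ * (((j : ℝ) + 1) ^ 2 * Θ₀ ^ j) := by positivity
  have hκc : 0 ≤ κ * c₂ := mul_nonneg hκ hc₂0
  calc 2 * κ * tH * c₂ = 2 * tH * (κ * c₂) := by ring
    _ ≤ 2 * 1 * (cc₂ * (((j : ℝ) + 1) ^ 2 * Θ₀ ^ j)) := by gcongr
    _ = 2 * cc₂ * (((j : ℝ) + 1) ^ 2 * Θ₀ ^ j) := by ring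

/-- **Term 3: `4c₁√(κtH/2) ≤ 4c̄₁·Φ_j`** (`√κ·4^j ≤ Θ₀^j`). [cite: ElgindiLissMattingly2025, §1.2.1] -/
theorem term_three_le {κ tH c₁ cc₁ Θ₀ : ℝ} (hκ : 0 ≤ κ) (htH1 : tH ≤ 1)
    (hcc₁ : 0 ≤ cc₁) (j : ℕ) (hc₁le : c₁ ≤ cc₁ * (((j : ℝ) + 1) * 4 ^ j))
    (hκ4 : Real.sqrt κ * 4 ^ j ≤ Θ₀ ^ j) :
    4 * c₁ * Real.sqrt (κ * tH / 2) ≤ 4 * cc₁ * (((j : ℝ) + 1) ^ 2 * Θ₀ ^ j) := by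
  have hj1 : (1 : ℝ) ≤ (j : ℝ) + 1 := by have : (0 : ℝ) ≤ j := Nat.cast_nonneg j; linarith
  have hj2 : (j : ℝ) + 1 ≤ ((j : ℝ) + 1) ^ 2 := le_self_pow₀ hj1 (by norm_num)
  have hs : Real.sqrt (κ * tH / 2) ≤ Real.sqrt κ := by
    refine Real.sqrt_le_sqrt ?_
    have := mul_le_mul_of_nonneg_left htH1 hκ
    linarith only [this, hκ]
  calc 4 * c₁ * Real.sqrt (κ * tH / 2) ≤ 4 * (cc₁ * (((j : ℝ) + 1) * 4 ^ j)) * Real.sqrt κ := by gcongr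
    _ = 4 * cc₁ * (((j : ℝ) + 1) * (Real.sqrt κ * 4 ^ j)) := by ring
    _ ≤ 4 * cc₁ * (((j : ℝ) + 1) ^ 2 * Θ₀ ^ j) := by gcongr

/-- **Term 4 (slot flatness): `√(4γε_j(5 + 6c₁²κtH)) ≤ √(4γ(5+6c̄₁²)/1000)·Φ_j`** (`ε_j = 1/(1000Γ^j)`, `Γ^{-j} ≤ (Θ₀^j)²`,
`κ16^j ≤ (Θ₀^j)² ≤ 1`). [cite: ElgindiLissMattingly2025, §1.2.2] -/
theorem term_four_le {γ G κ tH c₁ cc₁ Θ₀ : ℝ} (hγ : 0 ≤ γ) (hG : 2 ≤ G) (hκ : 0 ≤ κ) (htH0 : 0 ≤ tH) (htH1 : tH ≤ 1)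
    (hΘ0 : 0 ≤ Θ₀) (hΘ1 : Θ₀ ≤ 1) (hhalf : 1 / 2 ≤ Θ₀ ^ 2) (j : ℕ) (hc₁0 : 0 ≤ c₁)
    (hc₁le : c₁ ≤ cc₁ * (((j : ℝ) + 1) * 4 ^ j)) (hκ16 : κ * 16 ^ j ≤ (Θ₀ ^ j) ^ 2) :
    Real.sqrt (γ * (2 * (2 * (1 / (1000 * G ^ j)))) * (5 + 6 * c₁ ^ 2 * κ * tH)) ≤
      Real.sqrt (γ * (4 / 1000) * (5 + 6 * cc₁ ^ 2)) * (((j : ℝ) + 1) ^ 2 * Θ₀ ^ j) := by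
  have hG0 : 0 < G := by linarith
  have hGj : 0 < G ^ j := pow_pos hG0 j
  have hj1 : (1 : ℝ) ≤ (j : ℝ) + 1 := by have : (0 : ℝ) ≤ j := Nat.cast_nonneg j; linarith
  have hj2 : (j : ℝ) + 1 ≤ ((j : ℝ) + 1) ^ 2 := le_self_pow₀ hj1 (by norm_num)
  have hj3 : (1 : ℝ) ≤ ((j : ℝ) + 1) ^ 2 := one_le_pow₀ hj1
  have hΘj : 0 ≤ Θ₀ ^ j := pow_nonneg hΘ0 j
  have h16j : ((4 : ℝ) ^ j) ^ 2 = 16 ^ j := by rw [← pow_mul, mul_comm, pow_mul]; norm_num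
  have hin : 5 + 6 * c₁ ^ 2 * κ * tH ≤ (5 + 6 * cc₁ ^ 2) * ((j : ℝ) + 1) ^ 2 := by
    have h1 : c₁ ^ 2 * κ ≤ cc₁ ^ 2 * ((j : ℝ) + 1) ^ 2 := by
      calc c₁ ^ 2 * κ ≤ (cc₁ * (((j : ℝ) + 1) * 4 ^ j)) ^ 2 * κ :=
            mul_le_mul_of_nonneg_right (pow_le_pow_left₀ hc₁0 hc₁le 2) hκ
        _ = cc₁ ^ 2 * ((j : ℝ) + 1) ^ 2 * (κ * 16 ^ j) := by rw [← h16j]; ring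
        _ ≤ cc₁ ^ 2 * ((j : ℝ) + 1) ^ 2 * 1 :=
            mul_le_mul_of_nonneg_left (hκ16.trans (pow_le_one₀ hΘj (pow_le_one₀ hΘ0 hΘ1))) (by positivity)
        _ = cc₁ ^ 2 * ((j : ℝ) + 1) ^ 2 := mul_one _
    have h2 : c₁ ^ 2 * κ * tH ≤ cc₁ ^ 2 * ((j : ℝ) + 1) ^ 2 := by
      calc c₁ ^ 2 * κ * tH ≤ c₁ ^ 2 * κ * 1 := mul_le_mul_of_nonneg_left htH1 (by positivity)
        _ ≤ cc₁ ^ 2 * ((j : ℝ) + 1) ^ 2 := by rw [mul_one]; exact h1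
    have h5 : (5 : ℝ) ≤ 5 * ((j : ℝ) + 1) ^ 2 := by linarith only [hj3]
    have h6 := mul_le_mul_of_nonneg_left h2 (by norm_num : (0 : ℝ) ≤ 6)
    linarith only [h5, h6]
  have hεΘ : γ * (2 * (2 * (1 / (1000 * G ^ j)))) ≤ γ * (4 / 1000) * (Θ₀ ^ j) ^ 2 := by
    calc γ * (2 * (2 * (1 / (1000 * G ^ j)))) = γ * (4 / 1000) * (G ^ j)⁻¹ := by field_simp; ring
      _ ≤ γ * (4 / 1000) * (Θ₀ ^ j) ^ 2 := mul_le_mul_of_nonneg_left (inv_pow_le_sq hG hhalf j) (by positivity)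
  have hrad : γ * (2 * (2 * (1 / (1000 * G ^ j)))) * (5 + 6 * c₁ ^ 2 * κ * tH) ≤
      (Real.sqrt (γ * (4 / 1000) * (5 + 6 * cc₁ ^ 2)) * (((j : ℝ) + 1) * Θ₀ ^ j)) ^ 2 := by
    rw [mul_pow, Real.sq_sqrt (by positivity)]
    calc γ * (2 * (2 * (1 / (1000 * G ^ j)))) * (5 + 6 * c₁ ^ 2 * κ * tH)
        ≤ (γ * (4 / 1000) * (Θ₀ ^ j) ^ 2) * ((5 + 6 * cc₁ ^ 2) * ((j : ℝ) + 1) ^ 2) :=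
          mul_le_mul hεΘ hin (by positivity) (by positivity)
      _ = γ * (4 / 1000) * (5 + 6 * cc₁ ^ 2) * (((j : ℝ) + 1) * Θ₀ ^ j) ^ 2 := by ring
  calc Real.sqrt (γ * (2 * (2 * (1 / (1000 * G ^ j)))) * (5 + 6 * c₁ ^ 2 * κ * tH))
      ≤ Real.sqrt (γ * (4 / 1000) * (5 + 6 * cc₁ ^ 2)) * (((j : ℝ) + 1) * Θ₀ ^ j) :=
        Real.sqrt_le_iff.2 ⟨by positivity, hrad⟩
    _ ≤ Real.sqrt (γ * (4 / 1000) * (5 + 6 * cc₁ ^ 2)) * (((j : ℝ) + 1) ^ 2 * Θ₀ ^ j) :=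
        mul_le_mul_of_nonneg_left (mul_le_mul_of_nonneg_right hj2 hΘj) (Real.sqrt_nonneg _)

/-- **Terms 6+7 (residual twist): with `Rw·ε_j ≤ c_R L₀/1000` (envelope radius `≤ c_R L₀Γ^j`, `ε_j = 1/(1000Γ^j)`):
`(2πRw·γ(2+8C₁)(M+4)Λ_j(3ε_j) + (2πRw·6γε_j)²)/ρ^j ≤ (E₂ + E₁²)·Φ_j`** with
`E₂ = 2π(c_RL₀/1000)γ(2+8C₁)(M̄+4)(2π/δ₀)·3`, `E₁ = 2π(c_RL₀/1000)·6γ`. [cite: ElgindiLissMattingly2025, §1.2.2] -/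
theorem twist_terms_le {γ δ₀ C₁ M Mb Rw εj cRL ρ Θ₀ : ℝ} (hγ : 0 ≤ γ) (hδ₀ : 0 < δ₀) (hC₁ : 0 ≤ C₁) (hMb : 0 ≤ Mb)
    (hρ : 0 < ρ) (hΘ0 : 0 ≤ Θ₀) (hΘ1 : Θ₀ ≤ 1) (h16 : 16 / ρ ≤ Θ₀ ^ 2) (j : ℕ) (hM : 0 ≤ M)
    (hMle : M ≤ Mb * ((j : ℝ) + 1)) (hRw : 0 ≤ Rw) (hεj : 0 ≤ εj) (hRwε : Rw * εj ≤ cRL) :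
    (2 * Real.pi * Rw * (γ * ((2 + 8 * C₁) * (M + 4) * (2 * Real.pi / δ₀ * 4 ^ j) * (3 * εj))) +
        (2 * Real.pi * Rw * (γ * (2 * (3 * εj)))) ^ 2) * (ρ ^ j)⁻¹ ≤
      (2 * Real.pi * cRL * (γ * ((2 + 8 * C₁) * (Mb + 4) * (2 * Real.pi / δ₀) * 3)) +
        (2 * Real.pi * cRL * (γ * 6)) ^ 2) * (((j : ℝ) + 1) ^ 2 * Θ₀ ^ j) := by
  have hρj : 0 < ρ ^ j := pow_pos hρ j
  have hj1 : (1 : ℝ) ≤ (j : ℝ) + 1 := by have : (0 : ℝ) ≤ j := Nat.cast_nonneg j; linarith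
  have hj2 : (j : ℝ) + 1 ≤ ((j : ℝ) + 1) ^ 2 := le_self_pow₀ hj1 (by norm_num)
  have hj3 : (1 : ℝ) ≤ ((j : ℝ) + 1) ^ 2 := one_le_pow₀ hj1
  have hΘj : 0 ≤ Θ₀ ^ j := pow_nonneg hΘ0 j
  have hcRL : 0 ≤ cRL := le_trans (by positivity) hRwε
  have hM4 : M + 4 ≤ (Mb + 4) * ((j : ℝ) + 1) := by
    have h4 : (4 : ℝ) ≤ 4 * ((j : ℝ) + 1) := by linarith only [hj1]
    linarith only [hMle, h4]
  have hrate4 : (4 / ρ) ^ j ≤ Θ₀ ^ j := (div_pow_le_sq hρ (by norm_num) (by norm_num) h16 j).trans (pow_sq_le_pow hΘ0 hΘ1 j)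
  have hrate1 : (ρ ^ j)⁻¹ ≤ ((j : ℝ) + 1) ^ 2 * Θ₀ ^ j := by
    calc (ρ ^ j)⁻¹ = (1 / ρ) ^ j := by rw [one_div, inv_pow]
      _ ≤ Θ₀ ^ j := (div_pow_le_sq hρ (by norm_num) (by norm_num) h16 j).trans (pow_sq_le_pow hΘ0 hΘ1 j)
      _ ≤ ((j : ℝ) + 1) ^ 2 * Θ₀ ^ j := le_mul_of_one_le_left hΘj hj3
  have hp1 : 2 * Real.pi * Rw * (γ * ((2 + 8 * C₁) * (M + 4) * (2 * Real.pi / δ₀ * 4 ^ j) * (3 * εj))) * (ρ ^ j)⁻¹ ≤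
      2 * Real.pi * cRL * (γ * ((2 + 8 * C₁) * (Mb + 4) * (2 * Real.pi / δ₀) * 3)) * (((j : ℝ) + 1) ^ 2 * Θ₀ ^ j) := by
    have hq : (M + 4) * (4 ^ j * (ρ ^ j)⁻¹) ≤ (Mb + 4) * (((j : ℝ) + 1) ^ 2 * Θ₀ ^ j) := by
      calc (M + 4) * (4 ^ j * (ρ ^ j)⁻¹) = (M + 4) * (4 / ρ) ^ j := by rw [div_pow]; field_simp
        _ ≤ (Mb + 4) * ((j : ℝ) + 1) * Θ₀ ^ j := mul_le_mul hM4 hrate4 (by positivity) (by positivity)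
        _ ≤ (Mb + 4) * ((j : ℝ) + 1) ^ 2 * Θ₀ ^ j := by gcongr
        _ = (Mb + 4) * (((j : ℝ) + 1) ^ 2 * Θ₀ ^ j) := by ring
    calc 2 * Real.pi * Rw * (γ * ((2 + 8 * C₁) * (M + 4) * (2 * Real.pi / δ₀ * 4 ^ j) * (3 * εj))) * (ρ ^ j)⁻¹
        = 2 * Real.pi * (Rw * εj) * (γ * ((2 + 8 * C₁) * (2 * Real.pi / δ₀) * 3)) * ((M + 4) * (4 ^ j * (ρ ^ j)⁻¹)) := by
          ring
      _ ≤ 2 * Real.pi * cRL * (γ * ((2 + 8 * C₁) * (2 * Real.pi / δ₀) * 3)) * ((Mb + 4) * (((j : ℝ) + 1) ^ 2 * Θ₀ ^ j)) := by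
          gcongr
      _ = _ := by ring
  have hp2 : (2 * Real.pi * Rw * (γ * (2 * (3 * εj)))) ^ 2 * (ρ ^ j)⁻¹ ≤
      (2 * Real.pi * cRL * (γ * 6)) ^ 2 * (((j : ℝ) + 1) ^ 2 * Θ₀ ^ j) := by
    have h1 : 2 * Real.pi * Rw * (γ * (2 * (3 * εj))) ≤ 2 * Real.pi * cRL * (γ * 6) := by
      calc 2 * Real.pi * Rw * (γ * (2 * (3 * εj))) = 2 * Real.pi * (Rw * εj) * (γ * 6) := by ring
        _ ≤ 2 * Real.pi * cRL * (γ * 6) := by gcongr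
    have h0 : 0 ≤ 2 * Real.pi * Rw * (γ * (2 * (3 * εj))) := by positivity
    exact mul_le_mul (pow_le_pow_left₀ h0 h1 2) hrate1 (by positivity) (by positivity)
  rw [add_mul]
  calc _ ≤ 2 * Real.pi * cRL * (γ * ((2 + 8 * C₁) * (Mb + 4) * (2 * Real.pi / δ₀) * 3)) * (((j : ℝ) + 1) ^ 2 * Θ₀ ^ j) +
        (2 * Real.pi * cRL * (γ * 6)) ^ 2 * (((j : ℝ) + 1) ^ 2 * Θ₀ ^ j) := add_le_add hp1 hp2
    _ = _ := by ring

/-- **Term 8 (new-symbol remainder under the root): `√(2(Cn/b_j)(c₂+2πc₁+π²)/(4√3π)) ≤ √(2Cn c_b(c̄₂+2πc̄₁+π²)/(4√3π))·Φ_j`.**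
[folklore] -/
theorem term_eight_le {Cn L₀ ρ γb c₁ c₂ cc₁ cc₂ Θ₀ : ℝ} (hL₀ : 0 < L₀) (hρ : 0 < ρ) (hγb : 0 < γb) (hCn : 0 ≤ Cn)
    (hΘ0 : 0 ≤ Θ₀) (h16 : 16 / ρ ≤ Θ₀ ^ 2) (hcc₁ : 0 ≤ cc₁) (hcc₂ : 0 ≤ cc₂) (j : ℕ)
    (hc₁le : c₁ ≤ cc₁ * (((j : ℝ) + 1) * 4 ^ j)) (hc₂le : c₂ ≤ cc₂ * (((j : ℝ) + 1) ^ 2 * 16 ^ j)) :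
    Real.sqrt (2 * (Cn / (L₀ * ρ ^ j / (20 * γb * (1 + 1 / 250))) *
        ((c₂ + 2 * Real.pi * c₁ + Real.pi ^ 2) / (2 * Real.sqrt 3 * (2 * Real.pi))))) ≤
      Real.sqrt (2 * (Cn * (20 * γb * (1 + 1 / 250) / L₀) *
        ((cc₂ + 2 * Real.pi * cc₁ + Real.pi ^ 2) / (2 * Real.sqrt 3 * (2 * Real.pi))))) * (((j : ℝ) + 1) ^ 2 * Θ₀ ^ j) := by
  have hj1 : (1 : ℝ) ≤ (j : ℝ) + 1 := by have : (0 : ℝ) ≤ j := Nat.cast_nonneg j; linarith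
  have hj2 : (j : ℝ) + 1 ≤ ((j : ℝ) + 1) ^ 2 := le_self_pow₀ hj1 (by norm_num)
  have hΘj : 0 ≤ Θ₀ ^ j := pow_nonneg hΘ0 j
  have hsum := c_sum_div_le hρ h16 hcc₁ hcc₂ j hc₁le hc₂le
  rw [div_fibreScale_eq hL₀ hρ hγb j Cn]
  have hrad : 2 * (Cn * (20 * γb * (1 + 1 / 250) / L₀) * (ρ ^ j)⁻¹ *
      ((c₂ + 2 * Real.pi * c₁ + Real.pi ^ 2) / (2 * Real.sqrt 3 * (2 * Real.pi)))) ≤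
      (Real.sqrt (2 * (Cn * (20 * γb * (1 + 1 / 250) / L₀) *
        ((cc₂ + 2 * Real.pi * cc₁ + Real.pi ^ 2) / (2 * Real.sqrt 3 * (2 * Real.pi))))) * (((j : ℝ) + 1) * Θ₀ ^ j)) ^ 2 := by
    rw [mul_pow, Real.sq_sqrt (by positivity)]
    calc 2 * (Cn * (20 * γb * (1 + 1 / 250) / L₀) * (ρ ^ j)⁻¹ *
          ((c₂ + 2 * Real.pi * c₁ + Real.pi ^ 2) / (2 * Real.sqrt 3 * (2 * Real.pi))))
        = 2 * (Cn * (20 * γb * (1 + 1 / 250) / L₀) *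
            (((c₂ + 2 * Real.pi * c₁ + Real.pi ^ 2) * (ρ ^ j)⁻¹) / (2 * Real.sqrt 3 * (2 * Real.pi)))) := by ring
      _ ≤ 2 * (Cn * (20 * γb * (1 + 1 / 250) / L₀) *
            (((cc₂ + 2 * Real.pi * cc₁ + Real.pi ^ 2) * (((j : ℝ) + 1) ^ 2 * (Θ₀ ^ j) ^ 2)) /
              (2 * Real.sqrt 3 * (2 * Real.pi)))) := by gcongr
      _ = 2 * (Cn * (20 * γb * (1 + 1 / 250) / L₀) *
            ((cc₂ + 2 * Real.pi * cc₁ + Real.pi ^ 2) / (2 * Real.sqrt 3 * (2 * Real.pi)))) *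
          (((j : ℝ) + 1) * Θ₀ ^ j) ^ 2 := by ring
  calc _ ≤ Real.sqrt (2 * (Cn * (20 * γb * (1 + 1 / 250) / L₀) *
        ((cc₂ + 2 * Real.pi * cc₁ + Real.pi ^ 2) / (2 * Real.sqrt 3 * (2 * Real.pi))))) * (((j : ℝ) + 1) * Θ₀ ^ j) :=
        Real.sqrt_le_iff.2 ⟨by positivity, hrad⟩
    _ ≤ _ := mul_le_mul_of_nonneg_left (mul_le_mul_of_nonneg_right hj2 hΘj) (Real.sqrt_nonneg _)

end Summit.AnomalousDissipation.AnomalousDissipation.Theorems.SawtoothPulseCascade.K1Ledger
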